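import Mathlib.Order.Filter.AtTopBot.Basic
import Literature.ModelTheory.FiniteModelTheory.CountingWidth
import Literature.ModelTheory.FiniteModelTheory.CFI
import HarnessLib

/-!
# Counting width of graph PARAMETERS (Dawar–Wilsenach 2025, Def. 2.1), its bridge to the tree's
`countingWidth` of a class, and the Cai–Fürer–Immerman lower bound (named facts)

Topic `Literature/ModelTheory/FiniteModelTheory`; definition request `defn-CountingWidth`, items
(2)–(3), rebased onto the tree's `CountingWidth.lean` (`countingWidth 𝒞 n` for a CLASS `𝒞`,
Atserias–Dawar's wording; the Atserias–Dawar–Ochremiak facts for Hamiltonicity and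
3-colourability live there) and `CkEquiv.lean` (`CkEquiv k G H`, Hella's bijective `k`-pebble
game).

* `IsGraphParameter μ` — an isomorphism-invariant `μ : FinGraph → α` with values in any sort
  (`ℕ`, a field — the number of perfect matchings, the permanent —, or `Prop` for graph
  PROPERTIES; `isGraphParameter_mem_iff` ↔ `IsIsoClosed`). [Dawar–Wilsenach 2025, §2.4]
* `paramCountingWidth μ n` — Dawar–Wilsenach's COUNTING WIDTH OF A GRAPH PARAMETER (Def. 2.1):
  the least `k` such that `μ` is `≡_{C^k}`-invariant on graphs with AT MOST `n` vertices (both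
  graphs bounded by `n`, as printed). PROVED API: `≤ n` (`IsGraphParameter.paramCountingWidth_le`),
  the defining property AT the width (`…_spec`), strict lower bounds from witnesses
  (`…lt_paramCountingWidth`), monotonicity in `n`, and "witnesses at every `k` with `c·k < n` ⇒
  `n ≤ c·ν(n)`" (`…le_mul_paramCountingWidth`).
* The PROVED BRIDGE to the tree's class version (whose defining set lets the non-member have any
  order): for isomorphism-closed `𝒞`,
  `paramCountingWidth (· ∈ 𝒞) n ≤ countingWidth 𝒞 n ≤ max (paramCountingWidth (· ∈ 𝒞) n) 1`
  (`paramCountingWidth_mem_le_countingWidth`, `countingWidth_le_max_paramCountingWidth_one`), with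
  equality as soon as the parameter width is positive (`countingWidth_eq_paramCountingWidth`); the
  two differ only in the degenerate corner `k = 0` (`CkEquiv 0` holds for all pairs, so a class
  containing every graph on `≤ n` vertices but not every graph has parameter width `0` and class
  width `1` at `n`).
* INDEXING: `k` = number of variables / pebble pairs (`C^k`), as `CkEquiv`; Dawar–Wilsenach index
  by Weisfeiler–Leman dimension (`≡ₖ` = `k`-WL = `≡_{C^{k+1}}`, Cai–Fürer–Immerman 1992 Thm 5.2;
  the tree's `WeisfeilerLeman.lean`), so their `ν(n)` is ours minus one whenever ours is positive;
  `Ω(n)` statements are insensitive to the shift.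
* NAMED FACTS (not proved): `caiFurerImmerman_cfiEquiv` — CFI 1992 Thm 6.4 in game form over the
  tree's uncoloured `cfiGraph` (`IsCFISeparator` = Def. 6.3); `exists_countingWidth_linear` — a
  graph property of counting width `Ω(n)` exists (CFI 1992 Cor. 6.5 as restated by Dawar–Wilsenach
  2025, §2.4), phrased with the tree's `countingWidth`.

NOT here: the transfer "symmetric threshold circuits with supports `≤ k(n)` decide only
`≡_{C^{O(k)}}`-invariant properties" (Anderson–Dawar 2017 Thm 6; Dawar–Wilsenach 2025 Thm 6.4) —
needs the vocabulary of symmetric circuits (definition request `defn-SymmetricCircuit`);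
non-isomorphism of even/odd uncoloured CFI graphs and polynomial-time decidability of `cfiQuery`
(caveats in `CFI.lean`).

## References

* A. Dawar, G. Wilsenach, *Symmetric arithmetic circuits*, Theory of Computing 21 (2025), §2.4
  ("A graph parameter is a function from graphs to a set X which is isomorphism invariant"),
  Def. 2.1 ("the counting width of μ is the function ν : ℕ → ℕ such that ν(n) is the smallest k
  such that for all graphs Γ, Δ of size at most n, if Γ ≡ᵏ Δ, then μ(Γ) = μ(Δ)"), the remark
  "ν(n) ≤ n", and "Cai, Fürer and Immerman … construct a graph property with counting width
  Ω(n)". Read pp. 5–6.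
* J.-Y. Cai, M. Fürer, N. Immerman, *An optimal lower bound on the number of variables for graph
  identification*, Combinatorica 12 (1992), §6: construction of `X(G)` for finite connected `G`
  of minimum degree `≥ 2`, Lemma 6.2, Def. 6.3, Thm 6.4, Cor. 6.5. Read (FOCS 1989 version)
  pp. 16–18.
* A. Atserias, A. Dawar, *Definable inapproximability*, J. Logic Comput. 29 (2019), §2.1
  (counting width of a class — the tree's `countingWidth`).
-/

namespace Literature.ModelTheory.FiniteModelTheory

open Filter

/-! ### Graph parameters -/

/-- A GRAPH PARAMETER: an isomorphism-invariant function on finite graphs (values in any sort: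
`ℕ`, a field, or `Prop` for graph PROPERTIES / classes of graphs). [Dawar–Wilsenach 2025, §2.4]
[cite: DawarWilsenach2025, §2.4 (graph parameter)] -/
def IsGraphParameter {α : Sort*} (μ : FinGraph → α) : Prop :=
  ∀ ⦃n m : ℕ⦄ (G : SimpleGraph (Fin n)) (H : SimpleGraph (Fin m)),
    Nonempty (G ≃g H) → μ ⟨n, G⟩ = μ ⟨m, H⟩

/-- A class of finite graphs is isomorphism-closed (`IsIsoClosed`, `CapturingPTIME.lean`) iff its
membership predicate is a graph parameter. [Dawar–Wilsenach 2025, §2.4 ("When X = {0,1} we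
identify μ with the class of graphs for which it is the indicator function … a graph property")]
[folklore] -/
theorem isGraphParameter_mem_iff (𝒞 : Set FinGraph) :
    IsGraphParameter (fun G => G ∈ 𝒞) ↔ IsIsoClosed 𝒞 :=
  ⟨fun h _ _ G H e => (h G H e).to_iff, fun h _ _ G H e => propext (h G H e)⟩

/-! ### Counting width of a parameter -/

/-- **COUNTING WIDTH OF A GRAPH PARAMETER** (Dawar–Wilsenach): `paramCountingWidth μ n` is the
least `k` such that `μ` is `≡_{C^k}`-INVARIANT ON GRAPHS WITH AT MOST `n` VERTICES (`G ≡_{C^k} H`,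
`|G|, |H| ≤ n` ⟹ `μ G = μ H`). For a graph parameter the set of such `k` contains `n`
(`IsGraphParameter.paramCountingWidth_le`); for a non-invariant `μ` it may be empty and the value
is the junk `sInf ∅ = 0`. For classes this agrees with the tree's `countingWidth 𝒞` up to the
corner `k = 0` (`countingWidth_eq_paramCountingWidth` and the two inequalities around it).
Indexed by `C^k` (variables / pebble pairs); Dawar–Wilsenach index by WL-dimension `= k - 1`.
[Dawar–Wilsenach 2025, Def. 2.1] [cite: DawarWilsenach2025, Definition 2.1] -/
noncomputable def paramCountingWidth {α : Sort*} (μ : FinGraph → α) (n : ℕ) : ℕ :=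
  sInf {k : ℕ | ∀ G H : FinGraph, G.1 ≤ n → H.1 ≤ n → CkEquiv k G.2 H.2 → μ G = μ H}

section ParamAPI

variable {α : Sort*} {μ : FinGraph → α}

/-- Any `k` for which `μ` is `≡_{C^k}`-invariant on graphs with `≤ n` vertices bounds the counting
width. [Dawar–Wilsenach 2025, Def. 2.1] [folklore] -/
theorem paramCountingWidth_le_of_invariant {n k : ℕ}
    (h : ∀ G H : FinGraph, G.1 ≤ n → H.1 ≤ n → CkEquiv k G.2 H.2 → μ G = μ H) :
    paramCountingWidth μ n ≤ k :=
  Nat.sInf_le h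

/-- A graph parameter is `≡_{C^n}`-invariant on graphs with at most `n` vertices: such graphs are
`≡_{C^n}` only if isomorphic (`CkEquiv.nonempty_iso`; at `n = 0` both are the graph on `Fin 0`).
[Dawar–Wilsenach 2025, §2.4 (remark after Def. 2.1)] [folklore] -/
theorem IsGraphParameter.invariant_self (hμ : IsGraphParameter μ) (n : ℕ) :
    ∀ G H : FinGraph, G.1 ≤ n → H.1 ≤ n → CkEquiv n G.2 H.2 → μ G = μ H := by
  rintro ⟨a, G⟩ ⟨b, H⟩ ha hb hGH
  rcases Nat.eq_zero_or_pos n with rfl | hn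
  · obtain rfl : a = 0 := Nat.le_zero.1 ha
    obtain rfl : b = 0 := Nat.le_zero.1 hb
    exact hμ G H ⟨⟨Equiv.refl (Fin 0), fun {x} => x.elim0⟩⟩
  · exact hμ G H (hGH.nonempty_iso hn (by simpa using ha))

/-- `paramCountingWidth μ n ≤ n` for every graph parameter. [Dawar–Wilsenach 2025, §2.4 ("for
any graph parameter ν(n) ≤ n")] [folklore] -/
theorem IsGraphParameter.paramCountingWidth_le (hμ : IsGraphParameter μ) (n : ℕ) :
    paramCountingWidth μ n ≤ n :=
  paramCountingWidth_le_of_invariant (hμ.invariant_self n)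

/-- The defining property holds AT the counting width: a graph parameter is
`≡_{C^{paramCountingWidth μ n}}`-invariant on graphs with at most `n` vertices.
[Dawar–Wilsenach 2025, Def. 2.1] [folklore] -/
theorem IsGraphParameter.paramCountingWidth_spec (hμ : IsGraphParameter μ) (n : ℕ) :
    ∀ G H : FinGraph, G.1 ≤ n → H.1 ≤ n → CkEquiv (paramCountingWidth μ n) G.2 H.2 → μ G = μ H :=
  Nat.sInf_mem (s := {k : ℕ | ∀ G H : FinGraph, G.1 ≤ n → H.1 ≤ n → CkEquiv k G.2 H.2 → μ G = μ H})
    ⟨n, hμ.invariant_self n⟩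

/-- Lower bounds by witnesses: two `≡_{C^k}` graphs with at most `n` vertices on which a graph
parameter differs force `k < paramCountingWidth μ n`. [Dawar–Wilsenach 2025, proof of Cor. 6.5
("we can find for each n a pair of graphs Γₙ, Δₙ with at most n vertices such that
Γₙ ≡^{κ(n)-1} Δₙ but μ(Γₙ) ≠ μ(Δₙ)")] [folklore] -/
theorem IsGraphParameter.lt_paramCountingWidth (hμ : IsGraphParameter μ) {n k : ℕ}
    {G H : FinGraph} (hG : G.1 ≤ n) (hH : H.1 ≤ n) (hGH : CkEquiv k G.2 H.2) (hne : μ G ≠ μ H) :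
    k < paramCountingWidth μ n := by
  by_contra hk
  exact hne (hμ.paramCountingWidth_spec n G H hG hH (hGH.mono (Nat.le_of_not_lt hk)))

/-- Counting width is monotone in `n`. [Dawar–Wilsenach 2025, Def. 2.1] [folklore] -/
theorem IsGraphParameter.paramCountingWidth_mono (hμ : IsGraphParameter μ) :
    Monotone (paramCountingWidth μ) := by
  intro n n' hnn'
  refine le_csInf ⟨n', hμ.invariant_self n'⟩ fun k hk => ?_
  exact paramCountingWidth_le_of_invariant fun G H hG hH hGH =>
    hk G H (hG.trans hnn') (hH.trans hnn') hGH

/-- From a family of witnesses at every `k` with `c * k < n` (the form of the published linear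
lower bounds) to `n ≤ c * paramCountingWidth μ n`. [Dawar–Wilsenach 2025, proof of Cor. 6.5]
[folklore] -/
theorem IsGraphParameter.le_mul_paramCountingWidth (hμ : IsGraphParameter μ) {c n : ℕ}
    (h : ∀ k : ℕ, c * k < n → ∃ G H : SimpleGraph (Fin n), CkEquiv k G H ∧ μ ⟨n, G⟩ ≠ μ ⟨n, H⟩) :
    n ≤ c * paramCountingWidth μ n := by
  by_contra hlt
  obtain ⟨G, H, hGH, hne⟩ := h _ (Nat.lt_of_not_le hlt)
  exact hne (hμ.paramCountingWidth_spec n ⟨n, G⟩ ⟨n, H⟩ le_rfl le_rfl hGH)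

end ParamAPI

/-! ### The bridge to the tree's `countingWidth` of a class -/

section Bridge

variable {𝒞 : Set FinGraph}

/-- Every `k` separating the members of `𝒞` with `≤ n` vertices from all non-members (the tree's
defining set) makes membership `≡_{C^k}`-invariant on graphs with `≤ n` vertices (Dawar–Wilsenach's
defining set); uses the symmetry of `≡_{C^k}`. [folklore] -/
theorem invariant_mem_of_separates {n k : ℕ}
    (h : ∀ A ∈ 𝒞, A.1 ≤ n → ∀ B ∉ 𝒞, ¬ CkEquiv k A.2 B.2) :
    ∀ G H : FinGraph, G.1 ≤ n → H.1 ≤ n → CkEquiv k G.2 H.2 → (G ∈ 𝒞) = (H ∈ 𝒞) := by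
  intro G H hG hH hGH
  refine propext ⟨fun hGm => ?_, fun hHm => ?_⟩
  · by_contra hHm
    exact h G hGm hG H hHm hGH
  · by_contra hGm
    exact h H hHm hH G hGm hGH.symm

/-- For an isomorphism-closed class the tree's defining set is never empty: `k = n + 1` separates
(different orders by one bijection move, equal orders `≤ n` by `CkEquiv.nonempty_iso`).
[Atserias–Dawar 2019, §2.1 ("k(n) ≤ n")] [folklore] -/
theorem separates_succ (h𝒞 : IsIsoClosed 𝒞) (n : ℕ) :
    ∀ A ∈ 𝒞, A.1 ≤ n → ∀ B ∉ 𝒞, ¬ CkEquiv (n + 1) A.2 B.2 :=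
  separates_of_le h𝒞 (Nat.succ_pos n) (Nat.le_succ n)

/-- **Bridge, first half:** Dawar–Wilsenach's width of the membership parameter is at most the
tree's counting width of the class (isomorphism-closed `𝒞`). [folklore] -/
theorem paramCountingWidth_mem_le_countingWidth (h𝒞 : IsIsoClosed 𝒞) (n : ℕ) :
    paramCountingWidth (fun G => G ∈ 𝒞) n ≤ countingWidth 𝒞 n :=
  paramCountingWidth_le_of_invariant (invariant_mem_of_separates
    (Nat.sInf_mem (s := {k : ℕ | ∀ A ∈ 𝒞, A.1 ≤ n → ∀ B ∉ 𝒞, ¬ CkEquiv k A.2 B.2})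
      ⟨n + 1, separates_succ h𝒞 n⟩))

/-- Every POSITIVE `k` at which membership is `≡_{C^k}`-invariant on graphs with `≤ n` vertices
separates members with `≤ n` vertices from all non-members (a non-member of larger order is told
apart by Duplicator's first bijection). [folklore] -/
theorem separates_of_invariant_mem {n k : ℕ} (hk : 0 < k)
    (h : ∀ G H : FinGraph, G.1 ≤ n → H.1 ≤ n → CkEquiv k G.2 H.2 → (G ∈ 𝒞) = (H ∈ 𝒞)) :
    ∀ A ∈ 𝒞, A.1 ≤ n → ∀ B ∉ 𝒞, ¬ CkEquiv k A.2 B.2 := by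
  intro A hA hAn B hB hAB
  by_cases hBn : B.1 ≤ n
  · exact hB ((h A B hAn hBn hAB).to_iff.1 hA)
  · have hcard := hAB.card_eq hk
    simp only [Fintype.card_fin] at hcard
    omega

/-- **Bridge, second half:** the tree's counting width is at most the parameter width or `1`.
[folklore] -/
theorem countingWidth_le_max_paramCountingWidth_one (h𝒞 : IsIsoClosed 𝒞) (n : ℕ) :
    countingWidth 𝒞 n ≤ max (paramCountingWidth (fun G => G ∈ 𝒞) n) 1 := by
  have hμ : IsGraphParameter (fun G => G ∈ 𝒞) := (isGraphParameter_mem_iff 𝒞).2 h𝒞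
  refine countingWidth_le_of_separates (separates_of_invariant_mem (lt_max_of_lt_right one_pos)
    fun G H hG hH hGH => ?_)
  exact hμ.paramCountingWidth_spec n G H hG hH (hGH.mono (le_max_left _ _))

/-- **Bridge:** whenever the parameter width is positive it EQUALS the tree's counting width of the
class. (They differ only when `CkEquiv 0` — always true — already leaves membership invariant on
graphs with `≤ n` vertices while some non-member exists elsewhere.) [Dawar–Wilsenach 2025, Def.
2.1 vs Atserias–Dawar 2019, §2.1] [folklore] -/
theorem countingWidth_eq_paramCountingWidth (h𝒞 : IsIsoClosed 𝒞) {n : ℕ}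
    (hpos : 0 < paramCountingWidth (fun G => G ∈ 𝒞) n) :
    countingWidth 𝒞 n = paramCountingWidth (fun G => G ∈ 𝒞) n := by
  refine le_antisymm ?_ (paramCountingWidth_mem_le_countingWidth h𝒞 n)
  have h := countingWidth_le_max_paramCountingWidth_one h𝒞 n
  rwa [max_eq_left hpos] at h

/-- Hence a witness lower bound stated for the parameter width transfers to the tree's counting
width: two `≡_{C^k}` graphs with `≤ n` vertices, one in `𝒞` and one not, force
`k < countingWidth 𝒞 n`. [Dawar–Wilsenach 2025, proof of Cor. 6.5] [folklore] -/
theorem IsIsoClosed.lt_countingWidth (h𝒞 : IsIsoClosed 𝒞) {n k : ℕ} {G H : FinGraph}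
    (hG : G.1 ≤ n) (hH : H.1 ≤ n) (hGH : CkEquiv k G.2 H.2) (hmem : G ∈ 𝒞) (hnmem : H ∉ 𝒞) :
    k < countingWidth 𝒞 n :=
  (((isGraphParameter_mem_iff 𝒞).2 h𝒞).lt_paramCountingWidth hG hH hGH
    fun heq => hnmem (heq.to_iff.1 hmem)).trans_le (paramCountingWidth_mem_le_countingWidth h𝒞 n)

/-- And the linear form: witnesses at every `k` with `c * k < n`, one in `𝒞` and one not, give
`n ≤ c * countingWidth 𝒞 n`. [Dawar–Wilsenach 2025, §2.4] [folklore] -/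
theorem IsIsoClosed.le_mul_countingWidth (h𝒞 : IsIsoClosed 𝒞) {c n : ℕ}
    (h : ∀ k : ℕ, c * k < n → ∃ G H : SimpleGraph (Fin n), CkEquiv k G H ∧ ⟨n, G⟩ ∈ 𝒞 ∧ ⟨n, H⟩ ∉ 𝒞) :
    n ≤ c * countingWidth 𝒞 n := by
  refine (((isGraphParameter_mem_iff 𝒞).2 h𝒞).le_mul_paramCountingWidth fun k hk => ?_).trans
    (Nat.mul_le_mul_left c (paramCountingWidth_mem_le_countingWidth h𝒞 n))
  obtain ⟨G, H, hGH, hG, hH⟩ := h k hk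
  exact ⟨G, H, hGH, fun heq => hH (heq.to_iff.1 hG)⟩

end Bridge

/-! ### The Cai–Fürer–Immerman lower bound (named facts) -/

/-- A SEPARATOR of a graph `T` on `Fin v` in the sense of Cai–Fürer–Immerman: a vertex set `S`
such that the subgraph induced on the complement of `S` has no connected component with more
than `v / 2` vertices. [Cai–Fürer–Immerman 1992, Def. 6.3] [cite: CaiFurerImmerman1992, Definition 6.3] -/
def IsCFISeparator {v : ℕ} (T : SimpleGraph (Fin v)) (S : Set (Fin v)) : Prop :=
  ∀ C : (T.induce Sᶜ).ConnectedComponent, 2 * C.supp.ncard ≤ v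

/-- **The Cai–Fürer–Immerman theorem (game form).** Printed: "Let `T` be a graph such that every
separator of `T` has at least `s + 1` vertices. Then `X(T) ≡_{C^s} X̃(T)`" — Duplicator wins the
bijective `s`-pebble game on the untwisted CFI graph `CFI(T, ∅)` and the once-twisted `CFI(T, {e})`
(`e` any edge). CFI construct `X(G)` only for FINITE CONNECTED `G` OF MINIMUM DEGREE `≥ 2` (§6,
before Lemma 6.2), the standing setting of their Thm 6.4; since the tree's uncoloured `cfiGraph`
is defined for every `T`, these standing hypotheses are carried here EXPLICITLY (`T.Connected`,
`∀ u, 2 ≤ T.degree u`) — a restriction to CFI's setting, not hypotheses added to their theorem.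
Printed for the vertex-coloured CFI graphs over an individualised `T` ("this only makes life
more difficult for Player II"); a winning strategy there is a fortiori one for the uncoloured
graphs, whose partial isomorphisms need not respect colours. NON-isomorphism of the two graphs
(CFI Lemma 6.2, proved with colours) is NOT part of this statement. [Cai–Fürer–Immerman 1992,
Thm 6.4 (with Def. 6.3, Lemma 6.2, Thm 5.2)] [cite: CaiFurerImmerman1992, Theorem 6.4] -/
def caiFurerImmerman_cfiEquiv : Prop :=
  ∀ (v s : ℕ) (T : SimpleGraph (Fin v)) [DecidableRel T.Adj],
    T.Connected → (∀ u, 2 ≤ T.degree u) →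
    (∀ S : Set (Fin v), IsCFISeparator T S → s + 1 ≤ S.ncard) →
    ∀ e ∈ T.edgeSet, ∀ [DecidablePred (· ∈ ({e} : Set (Sym2 (Fin v))))],
      CkEquiv s (cfiEven T) (cfiGraph T ({e} : Set (Sym2 (Fin v))))

/-- **A graph property of LINEAR counting width exists** (the CFI property over 3-regular
expanders): there is an isomorphism-closed class `𝒞` of finite graphs and `c` with
`n ≤ c · countingWidth 𝒞 n` for all large `n`, i.e. counting width `Ω(n)` (the tree's
`countingWidth` of a class). [Dawar–Wilsenach 2025, §2.4 ("Cai, Fürer and Immerman [9] first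
showed that there is no fixed k for which ≡ᵏ coincides with isomorphism. Indeed, in our
terminology, they construct a graph property with counting width Ω(n)"); Cai–Fürer–Immerman
1992, Cor. 6.5 (pairs `Gₙ ≡ Hₙ` in `C^{Ω(n)}`, `Gₙ ≇ Hₙ`, `O(n)` vertices)]
[cite: DawarWilsenach2025, §2.4 (a graph property with counting width Ω(n))] -/
def exists_countingWidth_linear : Prop :=
  ∃ 𝒞 : Set FinGraph, IsIsoClosed 𝒞 ∧
    ∃ c : ℕ, ∀ᶠ n : ℕ in atTop, n ≤ c * countingWidth 𝒞 n

end Literature.ModelTheory.FiniteModelTheory
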